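import Literature.MathematicalPhysics.QuantumFieldTheory.QCDOS
import Literature.MathematicalPhysics.QuantumFieldTheory.MassGapFromSpanClustering
import HarnessLib

/-!
# The full-spectrum mass gap of OS data from Cauchy–Schwarz clustering of a lattice approximation

Topic `MathematicalPhysics/QuantumFieldTheory` (families `constructive-qft`, `yang-mills`); sequel of
`MassGapFromSpanClustering`.

**What transfers from a lattice approximation to the continuum gap clause.**  A lattice
approximation (`IsQCDAlong`, `IsYangMillsFor`: convergence of lattice `n`-point functions
`Λ k n σ f` to `𝔖ₙ^σ(f₁ ⊗ ⋯ ⊗ fₙ)` on OFF-DIAGONAL REAL PRODUCT tensors) pins `𝔖` only there, and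
per-pair clustering constants survive the limit only as continuous functionals of the test functions
— the reflection-positive norms of the transfer-matrix bound
`|⟨F̂Ω, (e^{−tH} − |Ω⟩⟨Ω|) ĜΩ⟩| ≤ e^{−Δt} ‖F̂Ω‖ ‖ĜΩ‖`, which Lüscher's positive transfer matrix
with spectral gap `Δ` (physical units) gives on the lattice for every finite linear combination of
product observables.  This file proves that this, and only this much, is needed:

* `IsSlabOrdered p` — slab-ordered real factor data (the factor data of `slabOrderedProducts`);
* `ClustersCS d Λ Δ` — the LATTICE statement: for finite families of slab-ordered real factor data
  with complex coefficients, all `t ≥ 0`, `ε > 0`, EVENTUALLY in `k` the sesquilinearly expanded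
  Cauchy–Schwarz clustering bound for `Λ k` (on the `(n+m)`-, `n`-, `m`-, `2n`-, `2m`-point functions
  of the reflected / translated factor families), with slack `ε` (absorbs finite-volume and `O(a_k)`
  time-mismatch errors);
* `OSData.hasMassGap_of_clustersCS` — if `Λ k → 𝔖` on off-diagonal real product tensors (`n ≥ 1`)
  and `ClustersCS d Λ Δ`, then `T.HasMassGap Δ` (termwise limits, `ε → 0`, then
  `OSData.hasMassGap_of_csBound_span`);
* instances: `QCDScheme.HasSpeciesCSClustering` / `IsQCDAlong.hasMassGap_of_hasSpeciesCSClustering`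
  (the continuum gap clause of `QCDOf`), `SpeciesScheme.HasCSClustering` /
  `IsYangMillsFor.hasMassGap_of_hasCSClustering` (that of `YangMillsOf`).

By the convergence, `ClustersCS d Λ Δ` is EQUIVALENT to the Cauchy–Schwarz gap bound of `T` on the
spans of slab-ordered real product tensors; it replaces hypotheses of the form `HasLatticeMassGap`
(per-pair `∃ C` before `∀ᶠ k`, local observables, lattice times), which do not pass to the limit.

References: M. Lüscher, CMP 54 (1977) 283 (positive transfer matrix for Wilson fermions)
[Luscher1977]; K. Osterwalder, E. Seiler, Ann. Phys. 110 (1978) §2–§4 [OsterwalderSeiler1978];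
J. Glimm, A. Jaffe, *Quantum Physics* (1987) §6.1 Thm. 6.1.3 [GlimmJaffeQP1987];
A. Jaffe, E. Witten, *Quantum Yang–Mills theory* (2000) §4–§5 [JaffeWitten2000];
K. Osterwalder, R. Schrader, CMP 31 (1973) §2 [OsterwalderSchraderCMP1973].
Mathlib: `Submodule.mem_span_set'`, `le_of_tendsto_of_tendsto`, `le_of_forall_pos_le_add`.
Tree: `IsTensorOf.osAdjoint/appendTensor/translateMulti`, `append_ofRealTest`,
`OSReconstructionNoE1.isOffDiagonal_appendTensor_osAdjoint`, `IsOffDiagonal.osAdjoint`,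
`IsTimeOrdered.of_mem_slabOrderedProducts`.
-/

open scoped SchwartzMap ComplexConjugate
open Filter Topology Complex Set
open Literature.MathematicalPhysics.AQFT Literature.MathematicalPhysics.QuantumLattice

noncomputable section

namespace Literature.MathematicalPhysics.QuantumFieldTheory

variable {d : ℕ} [NeZero d] {n m : ℕ}

/-! ### Slab-ordered real factor data and the lattice statement -/

/-- **Slab-ordered real factor data**: the family `p : Fin n → 𝓢(ℝ^d, ℝ)` admits time slabs
`lo i ≤ hi i` with `0 < lo i`, `hi i < lo j` for `i < j`, and `supp pᵢ ⊆ {lo i ≤ x⁰ ≤ hi i}` — the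
factor data of the tree's `slabOrderedProducts` (OS's elementary tensors of `𝒮_<`). [cite: OsterwalderSchraderCMP1973, §2 pp. 86–87] -/
def IsSlabOrdered (p : Fin n → 𝓢(EuclideanSpace ℝ (Fin d), ℝ)) : Prop :=
  ∃ lo hi : Fin n → ℝ, (∀ i, 0 < lo i) ∧ (∀ i, lo i ≤ hi i) ∧ (∀ i j, i < j → hi i < lo j) ∧
    ∀ i, tsupport (p i : EuclideanSpace ℝ (Fin d) → ℝ) ⊆ {x | lo i ≤ x 0 ∧ x 0 ≤ hi i}

/-- A real product tensor with slab-ordered factor data is a slab-ordered real product tensor. [folklore] -/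
theorem IsSlabOrdered.mem_slabOrderedProducts {p : Fin n → 𝓢(EuclideanSpace ℝ (Fin d), ℝ)}
    (hp : IsSlabOrdered p) {P : 𝓢((Fin n → EuclideanSpace ℝ (Fin d)), ℂ)}
    (hP : IsTensorOf P fun i => ofRealTest (p i)) : P ∈ slabOrderedProducts d n := by
  obtain ⟨lo, hi, hlo, hle, hord, hsupp⟩ := hp
  exact ⟨p, lo, hi, hP, hlo, hle, hord, hsupp⟩

/-- A slab-ordered real product tensor has slab-ordered factor data. [folklore] -/
theorem exists_isSlabOrdered_of_mem_slabOrderedProducts {P : 𝓢((Fin n → EuclideanSpace ℝ (Fin d)), ℂ)}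
    (hP : P ∈ slabOrderedProducts d n) :
    ∃ p : Fin n → 𝓢(EuclideanSpace ℝ (Fin d), ℝ), IsTensorOf P (fun i => ofRealTest (p i)) ∧
      IsSlabOrdered p := by
  obtain ⟨p, lo, hi, hP, hlo, hle, hord, hsupp⟩ := hP
  exact ⟨p, hP, lo, hi, hlo, hle, hord, hsupp⟩

variable (d) in
/-- **Cauchy–Schwarz clustering at rate `Δ` of a lattice approximation `Λ`** (`Λ k n σ f` = the
step-`k` lattice `n`-point function of the species string `σ` on the real factor functions `f`):
for all arities `n, m ≥ 1`, label strings `σ, σ'`, finite families of slab-ordered real factor data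
`p, q` with coefficients `c, c'`, all `t ≥ 0` and `ε > 0`, EVENTUALLY in `k`,
`‖∑ᵢⱼ c̄ᵢ c'ⱼ (Λᵏ_{n+m}(θpᵢʳ ++ T_t qⱼ) − Λᵏₙ(θpᵢʳ) Λᵏₘ(qⱼ))‖ ≤
 e^{−Δt} √‖∑ᵢᵢ' c̄ᵢ cᵢ' Λᵏ₂ₙ(θpᵢʳ ++ pᵢ')‖ √‖∑ⱼⱼ' c̄'ⱼ c'ⱼ' Λᵏ₂ₘ(θqⱼʳ ++ qⱼ')‖ + ε`
(`θpʳ`: time-reflected factors in reversed order; `T_t`: time translation) — on the lattice this is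
`|⟨F̂Ω, (𝕋^{t/a} − |Ω⟩⟨Ω|) ĜΩ⟩| ≤ e^{−Δt} ‖F̂Ω‖ ‖ĜΩ‖` for `F = ∑ cᵢ ⊗pᵢ`, `G = ∑ c'ⱼ ⊗qⱼ`, which
Lüscher's positive transfer matrix with spectral gap `Δ` in physical units delivers; the slack `ε`
absorbs finite-volume and `O(a_k)` time-mismatch errors. [cite: Luscher1977] [cite: OsterwalderSeiler1978, §§2–4] -/
def ClustersCS {ι : Type} (Λ : ℕ → (n : ℕ) → (Fin n → ι) →
      (Fin n → 𝓢(EuclideanSpace ℝ (Fin d), ℝ)) → ℂ) (Δ : ℝ) : Prop :=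
  ∀ (n m : ℕ), n ≠ 0 → m ≠ 0 → ∀ (σ : Fin n → ι) (σ' : Fin m → ι) (N N' : ℕ) (c : Fin N → ℂ)
    (c' : Fin N' → ℂ) (p : Fin N → Fin n → 𝓢(EuclideanSpace ℝ (Fin d), ℝ))
    (q : Fin N' → Fin m → 𝓢(EuclideanSpace ℝ (Fin d), ℝ)),
    (∀ i, IsSlabOrdered (p i)) → (∀ j, IsSlabOrdered (q j)) →
    ∀ t : ℝ, 0 ≤ t → ∀ ε : ℝ, 0 < ε → ∀ᶠ k in atTop,
      ‖∑ i, ∑ j, conj (c i) * c' j *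
          (Λ k (n + m) (Fin.append (σ ∘ Fin.rev) σ')
              (Fin.append (fun l => thetaTest d (p i (Fin.rev l)))
                (fun l => translateTest (EuclideanSpace.single 0 t) (q j l))) -
            Λ k n (σ ∘ Fin.rev) (fun l => thetaTest d (p i (Fin.rev l))) * Λ k m σ' (q j))‖ ≤
        Real.exp (-Δ * t) *
            Real.sqrt ‖∑ i, ∑ i', conj (c i) * c i' *
              Λ k (n + n) (Fin.append (σ ∘ Fin.rev) σ)
                (Fin.append (fun l => thetaTest d (p i (Fin.rev l))) (p i'))‖ *
            Real.sqrt ‖∑ j, ∑ j', conj (c' j) * c' j' *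
              Λ k (m + m) (Fin.append (σ' ∘ Fin.rev) σ')
                (Fin.append (fun l => thetaTest d (q j (Fin.rev l))) (q j'))‖ + ε

namespace OSData

variable {ι : Type}

/-- **The transfer: Cauchy–Schwarz clustering of a lattice approximation ⇒ full-spectrum gap.**
If `Λ k → 𝔖` on the off-diagonal real product tensors of every degree `n ≥ 1` (the convergence
clause of `IsQCDAlong` / `IsYangMillsFor`) and `ClustersCS Λ Δ`, then `T.HasMassGap Δ` (`d ≥ 2`).
Proof: for `F = ∑ cᵢPᵢ`, `G = ∑ c'ⱼQⱼ` in the spans of slab-ordered real product tensors, expand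
sesquilinearly; every term is the limit of its lattice counterpart (`ΘPᵢ* ⊗ T_t Qⱼ`, `ΘPᵢ*`, `Qⱼ`,
`ΘPᵢ* ⊗ Pᵢ'` are off-diagonal real product tensors); pass to the limit, let `ε → 0`, and apply
`hasMassGap_of_csBound_span`. [cite: GlimmJaffeQP1987, §6.1 Thm. 6.1.3] [cite: OsterwalderSeiler1978, §§2–4] -/
theorem hasMassGap_of_clustersCS (T : OSData ι d) (hd : 1 < d)
    (Λ : ℕ → (n : ℕ) → (Fin n → ι) → (Fin n → 𝓢(EuclideanSpace ℝ (Fin d), ℝ)) → ℂ)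
    (hΛ : ∀ (n : ℕ), n ≠ 0 → ∀ (σ : Fin n → ι) (f : Fin n → 𝓢(EuclideanSpace ℝ (Fin d), ℝ))
      (F : 𝓢((Fin n → EuclideanSpace ℝ (Fin d)), ℂ)), IsTensorOf F (fun i => ofRealTest (f i)) →
      IsOffDiagonal F → Tendsto (fun k => Λ k n σ f) atTop (𝓝 (T.schwinger n σ F)))
    {Δ : ℝ} (hCS : ClustersCS d Λ Δ) : T.HasMassGap Δ := by
  refine hasMassGap_of_csBound_span T hd Δ fun n m hn hm k k' F G hF hG t ht => ?_
  obtain ⟨N, c, g, rfl⟩ := Submodule.mem_span_set'.1 hF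
  obtain ⟨N', c', g', rfl⟩ := Submodule.mem_span_set'.1 hG
  have hg : ∀ i, ∃ p : Fin n → 𝓢(EuclideanSpace ℝ (Fin d), ℝ),
      IsTensorOf (g i : 𝓢((Fin n → EuclideanSpace ℝ (Fin d)), ℂ)) (fun l => ofRealTest (p l)) ∧
        IsSlabOrdered p := fun i => exists_isSlabOrdered_of_mem_slabOrderedProducts (g i).2
  have hg' : ∀ j, ∃ q : Fin m → 𝓢(EuclideanSpace ℝ (Fin d), ℝ),
      IsTensorOf (g' j : 𝓢((Fin m → EuclideanSpace ℝ (Fin d)), ℂ)) (fun l => ofRealTest (q l)) ∧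
        IsSlabOrdered q := fun j => exists_isSlabOrdered_of_mem_slabOrderedProducts (g' j).2
  choose p hpT hp using hg
  choose q hqT hq using hg'
  have hPi : ∀ i, IsTimeOrdered (g i : 𝓢((Fin n → EuclideanSpace ℝ (Fin d)), ℂ)) := fun i =>
    IsTimeOrdered.of_mem_slabOrderedProducts (g i).2
  have hQj : ∀ j, IsTimeOrdered (g' j : 𝓢((Fin m → EuclideanSpace ℝ (Fin d)), ℂ)) := fun j =>
    IsTimeOrdered.of_mem_slabOrderedProducts (g' j).2
  set a : EuclideanSpace ℝ (Fin d) := EuclideanSpace.single 0 t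
  -- the continuum quantities of the expansion and their lattice approximants
  have hA : ∀ i j, Tendsto (fun κ => Λ κ (n + m) (Fin.append (k ∘ Fin.rev) k')
        (Fin.append (fun l => thetaTest d (p i (Fin.rev l))) (fun l => translateTest a (q j l))))
      atTop (𝓝 (T.schwinger (n + m) (Fin.append (k ∘ Fin.rev) k')
        ((osAdjoint (g i : 𝓢((Fin n → EuclideanSpace ℝ (Fin d)), ℂ))).appendTensor
          (translateMulti a (g' j))))) := by
    intro i j
    refine hΛ (n + m) (by omega) _ _ _ ?_ ?_
    · have h := (hpT i).osAdjoint.appendTensor ((hqT j).translateMulti a)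
      rwa [append_ofRealTest] at h
    · exact OSReconstructionNoE1.isOffDiagonal_appendTensor_osAdjoint (hPi i)
        (OSReconstructionNoE1.isTimeOrdered_translateMulti (hQj j) (by simp [a, ht]))
  have hB : ∀ i, Tendsto (fun κ => Λ κ n (k ∘ Fin.rev) (fun l => thetaTest d (p i (Fin.rev l))))
      atTop (𝓝 (T.schwinger n (k ∘ Fin.rev)
        (osAdjoint (g i : 𝓢((Fin n → EuclideanSpace ℝ (Fin d)), ℂ))))) :=
    fun i => hΛ n hn _ _ _ (hpT i).osAdjoint (hPi i).isOffDiagonal.osAdjoint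
  have hC : ∀ j, Tendsto (fun κ => Λ κ m k' (q j)) atTop
      (𝓝 (T.schwinger m k' (g' j : 𝓢((Fin m → EuclideanSpace ℝ (Fin d)), ℂ)))) :=
    fun j => hΛ m hm _ _ _ (hqT j) (hQj j).isOffDiagonal
  have hD : ∀ i i', Tendsto (fun κ => Λ κ (n + n) (Fin.append (k ∘ Fin.rev) k)
        (Fin.append (fun l => thetaTest d (p i (Fin.rev l))) (p i')))
      atTop (𝓝 (T.schwinger (n + n) (Fin.append (k ∘ Fin.rev) k)
        ((osAdjoint (g i : 𝓢((Fin n → EuclideanSpace ℝ (Fin d)), ℂ))).appendTensor (g i')))) := by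
    intro i i'
    refine hΛ (n + n) (by omega) _ _ _ ?_ ?_
    · have h := (hpT i).osAdjoint.appendTensor (hpT i')
      rwa [append_ofRealTest] at h
    · exact OSReconstructionNoE1.isOffDiagonal_appendTensor_osAdjoint (hPi i) (hPi i')
  have hE : ∀ j j', Tendsto (fun κ => Λ κ (m + m) (Fin.append (k' ∘ Fin.rev) k')
        (Fin.append (fun l => thetaTest d (q j (Fin.rev l))) (q j')))
      atTop (𝓝 (T.schwinger (m + m) (Fin.append (k' ∘ Fin.rev) k')
        ((osAdjoint (g' j : 𝓢((Fin m → EuclideanSpace ℝ (Fin d)), ℂ))).appendTensor (g' j')))) := by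
    intro j j'
    refine hΛ (m + m) (by omega) _ _ _ ?_ ?_
    · have h := (hqT j).osAdjoint.appendTensor (hqT j')
      rwa [append_ofRealTest] at h
    · exact OSReconstructionNoE1.isOffDiagonal_appendTensor_osAdjoint (hQj j) (hQj j')
  -- sesquilinear expansions of the three continuum quantities
  have hL1 : T.schwinger (n + m) (Fin.append (k ∘ Fin.rev) k')
        ((osAdjoint (∑ i, c i • (g i : 𝓢((Fin n → EuclideanSpace ℝ (Fin d)), ℂ)))).appendTensor
          (translateMulti a (∑ j, c' j • (g' j : 𝓢((Fin m → EuclideanSpace ℝ (Fin d)), ℂ))))) -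
      T.schwinger n (k ∘ Fin.rev)
          (osAdjoint (∑ i, c i • (g i : 𝓢((Fin n → EuclideanSpace ℝ (Fin d)), ℂ)))) *
        T.schwinger m k' (∑ j, c' j • (g' j : 𝓢((Fin m → EuclideanSpace ℝ (Fin d)), ℂ))) =
      ∑ i, ∑ j, conj (c i) * c' j *
        (T.schwinger (n + m) (Fin.append (k ∘ Fin.rev) k')
            ((osAdjoint (g i : 𝓢((Fin n → EuclideanSpace ℝ (Fin d)), ℂ))).appendTensor
              (translateMulti a (g' j))) -
          T.schwinger n (k ∘ Fin.rev) (osAdjoint (g i : 𝓢((Fin n → EuclideanSpace ℝ (Fin d)), ℂ))) *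
            T.schwinger m k' (g' j : 𝓢((Fin m → EuclideanSpace ℝ (Fin d)), ℂ))) := by
    rw [map_sum, Finset.sum_congr rfl fun j _ => map_smul _ _ _,
      apply_osAdjoint_appendTensor_sum_smul, apply_osAdjoint_sum_smul, apply_sum_smul,
      Finset.sum_mul_sum, ← Finset.sum_sub_distrib]
    refine Finset.sum_congr rfl fun i _ => ?_
    rw [← Finset.sum_sub_distrib]
    exact Finset.sum_congr rfl fun j _ => by ring
  have hL2 : T.schwinger (n + n) (Fin.append (k ∘ Fin.rev) k)
      ((osAdjoint (∑ i, c i • (g i : 𝓢((Fin n → EuclideanSpace ℝ (Fin d)), ℂ)))).appendTensor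
        (∑ i, c i • (g i : 𝓢((Fin n → EuclideanSpace ℝ (Fin d)), ℂ)))) =
      ∑ i, ∑ i', conj (c i) * c i' * T.schwinger (n + n) (Fin.append (k ∘ Fin.rev) k)
        ((osAdjoint (g i : 𝓢((Fin n → EuclideanSpace ℝ (Fin d)), ℂ))).appendTensor (g i')) :=
    apply_osAdjoint_appendTensor_sum_smul _ _ _ _ _ _ _
  have hL3 : T.schwinger (m + m) (Fin.append (k' ∘ Fin.rev) k')
      ((osAdjoint (∑ j, c' j • (g' j : 𝓢((Fin m → EuclideanSpace ℝ (Fin d)), ℂ)))).appendTensor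
        (∑ j, c' j • (g' j : 𝓢((Fin m → EuclideanSpace ℝ (Fin d)), ℂ)))) =
      ∑ j, ∑ j', conj (c' j) * c' j' * T.schwinger (m + m) (Fin.append (k' ∘ Fin.rev) k')
        ((osAdjoint (g' j : 𝓢((Fin m → EuclideanSpace ℝ (Fin d)), ℂ))).appendTensor (g' j')) :=
    apply_osAdjoint_appendTensor_sum_smul _ _ _ _ _ _ _
  rw [hL1, hL2, hL3]
  -- the lattice inequality passes to the limit, for every ε > 0
  refine le_of_forall_pos_le_add fun ε hε => ?_
  have hev := hCS n m hn hm k k' N N' c c' p q hp hq t ht ε hε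
  refine le_of_tendsto_of_tendsto ?_ ?_ hev
  · refine Tendsto.norm (tendsto_finsetSum _ fun i _ => tendsto_finsetSum _ fun j _ => ?_)
    exact Tendsto.const_mul _ ((hA i j).sub ((hB i).mul (hC j)))
  · refine ((tendsto_const_nhds.mul ?_).mul ?_).add_const ε
    · refine (Tendsto.norm (tendsto_finsetSum _ fun i _ => tendsto_finsetSum _ fun i' _ => ?_)).sqrt
      exact Tendsto.const_mul _ (hD i i')
    · refine (Tendsto.norm (tendsto_finsetSum _ fun j _ => tendsto_finsetSum _ fun j' _ => ?_)).sqrt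
      exact Tendsto.const_mul _ (hE j j')

end OSData

/-! ### The two lattice gauge theories of the summit `QuantumFields` -/

/-- **Species Cauchy–Schwarz clustering of lattice QCD along a scheme at rate `Δ`**: `ClustersCS` for
the honest lattice QCD `n`-point functions `qcdLatticeSchwinger sch` of the smeared renormalised
species fields (any species renormalisations `z, shift` of the scheme) — the lattice statement from
which the continuum gap clause `T.HasMassGap Δ` of `QCDOf` is read off. [cite: Luscher1977] [cite: JaffeWitten2000, §5] -/
def QCDScheme.HasSpeciesCSClustering {Nf : ℕ} (sch : QCDScheme Nf) (Δ : ℝ) : Prop :=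
  ClustersCS 4 (qcdLatticeSchwinger sch) Δ

/-- **Continuum gap clause of QCD from species clustering**: `IsQCDAlong sch T` and
`sch.HasSpeciesCSClustering Δ` give `T.HasMassGap Δ`. [cite: JaffeWitten2000, §5] [cite: OsterwalderSeiler1978, §§2–4] -/
theorem IsQCDAlong.hasMassGap_of_hasSpeciesCSClustering {Nf : ℕ} {sch : QCDScheme Nf}
    {T : OSData (QCDField Nf) 4} (hT : IsQCDAlong sch T) {Δ : ℝ}
    (h : sch.HasSpeciesCSClustering Δ) : T.HasMassGap Δ :=
  OSData.hasMassGap_of_clustersCS T (by norm_num) (qcdLatticeSchwinger sch) hT.2.2 h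

section YangMills

variable {G : Type} [Group G] [MeasurableSpace G] [TopologicalSpace G] [IsTopologicalGroup G]
  [CompactSpace G] [BorelSpace G]

/-- **Cauchy–Schwarz clustering of lattice Yang–Mills along a species scheme at rate `Δ`**:
`ClustersCS` for the lattice `n`-point functions `latticeSchwinger r.ρ sch` of the smeared renormalised
gauge-invariant local observables — the lattice statement from which the continuum gap clause of
`YangMillsOf` is read off. [cite: Luscher1977] [cite: JaffeWitten2000, §4–§5] -/
def SpeciesScheme.HasCSClustering (r : LatticeRep G) (sch : SpeciesScheme (YMSpecies G)) (Δ : ℝ) : Prop :=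
  ClustersCS 4 (fun k n σ f => ((latticeSchwinger r.ρ sch (fun s => s.F) k n σ f : ℝ) : ℂ)) Δ

/-- **Continuum gap clause of Yang–Mills from clustering**: `IsYangMillsFor r sch T` and
`sch.HasCSClustering r Δ` give `T.HasMassGap Δ`. [cite: JaffeWitten2000, §4–§5] [cite: OsterwalderSeiler1978, §§2–4] -/
theorem IsYangMillsFor.hasMassGap_of_hasCSClustering {r : LatticeRep G}
    {sch : SpeciesScheme (YMSpecies G)} {T : OSData (YMSpecies G) 4} (hT : IsYangMillsFor r sch T)
    {Δ : ℝ} (h : sch.HasCSClustering r Δ) : T.HasMassGap Δ :=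
  OSData.hasMassGap_of_clustersCS T (by norm_num) _ hT h

end YangMills

end Literature.MathematicalPhysics.QuantumFieldTheory

end
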